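import Mathlib.GroupTheory.Nilpotent
import Mathlib.GroupTheory.Commutator.Basic
import Mathlib.GroupTheory.QuotientGroup.Defs
import Mathlib.Algebra.Lie.Basic
import Mathlib.Algebra.DirectSum.Basic
import Mathlib.Tactic.Group
import Mathlib.Tactic.Abel
import Literature.NumberTheory.Sieve.LinearEquationsInPrimesHostKraCubes
import HarnessLib

/-!
# The Lie ring of the lower central series of a group (Magnus, Witt, Lazard)

Topic `Literature/GroupTheory/CombinatorialGroupTheory`. For a group `G` with lower central series
`γ₀ = G ⊇ γ₁ = (G, G) ⊇ ⋯`, `γ_{n+1} = ⁅γ_n, G⁆` (Mathlib's `(⊤ : Subgroup G).lowerCentralSeries`;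
the classical numbering is shifted by one), the quotients `γ_n/γ_{n+1}` are abelian and the group
commutator `⁅x, y⁆ = x y x⁻¹ y⁻¹` induces on `gr(G) = ⊕ₙ γ_n/γ_{n+1}` the structure of a **Lie ring**,
with `⁅γ_m/γ_{m+1}, γ_n/γ_{n+1}⁆ ⊆ γ_{m+n+1}/γ_{m+n+2}` (Magnus 1937/1940, Witt 1937, Lazard 1954;
Serre, *Lie algebras and Lie groups*, Part I Ch. II; Labute 1970 §1 "the associated graded abelian
group `gr(G)` has the structure of a graded Lie algebra over `ℤ`, the bracket being induced by the
commutator"). Mathlib (pinned) has the lower central series, the commutator calculus and the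
Hall–Witt identity, but not this Lie ring; it is built here, fully proved.

## Main definitions and results

* `lcs G n = (⊤ : Subgroup G).lowerCentralSeries n`; `commutator_mem_lcs : x ∈ γ_m → y ∈ γ_n →
  ⁅x, y⁆ ∈ γ_{m+n+1}` (from the tree's `commutator_lowerCentralSeries_le`).
* `LCSPiece G n = γ_n/γ_{n+1}` as an additive commutative group, `LCSPiece.mk n x hx` the class of
  `x ∈ γ_n`; `GrLCS G = ⊕ₙ γ_n/γ_{n+1}`, `GrLCS.of n`, and the total symbol map
  `toGr G n : G → GrLCS G` (`x ↦` class of `x` in degree `n` if `x ∈ γ_n`, else `0`), with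
  `toGr_mul`, `toGr_inv`, `toGr_eq_zero_iff`, `toGr_conj`.
* the Lie ring structure `GrLCS.instLieRing` (bracket biadditive by the commutator identities,
  alternating, Jacobi from the Hall–Witt identity) and **the defining formula**
  `lie_toGr_toGr : ⁅toGr m x, toGr n y⁆ = toGr (m + n + 1) ⁅x, y⁆` (`x ∈ γ_m`, `y ∈ γ_n`).
* universal constructions out of `gr(G)`: `GrLCS.lift` (additive maps given degreewise by functions
  on `G` additive on `γ_n` and vanishing on `γ_{n+1}`), `GrLCS.liftLie` (a Lie ring morphism when the
  data turn commutators into brackets), uniqueness `GrLCS.hom_ext_toGr`, and the induction principle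
  `GrLCS.induction_on_toGr`.

## References

* W. Magnus, Über Beziehungen zwischen höheren Kommutatoren, J. reine angew. Math. 177 (1937).
* M. Lazard, Sur les groupes nilpotents et les anneaux de Lie, Ann. ENS 71 (1954), Ch. I.
* J.-P. Serre, *Lie algebras and Lie groups*, Part I, Ch. II (filtrations and the Lie algebra
  `gr(G)`).
* J. P. Labute, J. Algebra 14 (1970) 16–23, §1. [Labute1970]
-/

namespace Literature.GroupTheory.CombinatorialGroupTheory

open scoped commutatorElement
open Literature.NumberTheory.Sieve.HostKra (commutator_lowerCentralSeries_le)

variable (G : Type*) [Group G]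

/-! ## The lower central series and the commutator weights -/

/-- `γ_n(G)`, Mathlib's lower central series of `G` (`γ₀ = G`, `γ_{n+1} = ⁅γ_n, G⁆`). [folklore] -/
abbrev lcs (n : ℕ) : Subgroup G := (⊤ : Subgroup G).lowerCentralSeries n

variable {G}

/-- `γ` is decreasing. [folklore] -/
theorem lcs_antitone {m n : ℕ} (h : m ≤ n) : lcs G n ≤ lcs G m :=
  Subgroup.lowerCentralSeries_antitone ⊤ h

/-- `γ_{n+1} ⊆ γ_n`. [folklore] -/
theorem lcs_succ_le (n : ℕ) : lcs G (n + 1) ≤ lcs G n := lcs_antitone (Nat.le_succ n)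

/-- **Commutator weights add**: `x ∈ γ_m`, `y ∈ γ_n` ⟹ `⁅x, y⁆ ∈ γ_{m+n+1}`. [folklore] -/
theorem commutator_mem_lcs {m n : ℕ} {x y : G} (hx : x ∈ lcs G m) (hy : y ∈ lcs G n) :
    ⁅x, y⁆ ∈ lcs G (m + n + 1) :=
  commutator_lowerCentralSeries_le m n (Subgroup.commutator_mem_commutator hx hy)

/-- Variant with a prescribed target degree. [folklore] -/
theorem commutator_mem_lcs_of_eq {m n N : ℕ} (h : m + n + 1 = N) {x y : G} (hx : x ∈ lcs G m)
    (hy : y ∈ lcs G n) : ⁅x, y⁆ ∈ lcs G N := h ▸ commutator_mem_lcs hx hy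

/-- `⁅x, g⁆ ∈ γ_{n+1}` for `x ∈ γ_n` and any `g`. [folklore] -/
theorem commutator_mem_lcs_succ {n : ℕ} {x : G} (hx : x ∈ lcs G n) (g : G) : ⁅x, g⁆ ∈ lcs G (n + 1) :=
  Subgroup.commutator_mem_commutator hx (Subgroup.mem_top g)

/-- `⁅g, x⁆ ∈ γ_{n+1}` for `x ∈ γ_n` and any `g`. [folklore] -/
theorem commutator_mem_lcs_succ' {n : ℕ} (g : G) {x : G} (hx : x ∈ lcs G n) : ⁅g, x⁆ ∈ lcs G (n + 1) := by
  rw [← commutatorElement_inv, inv_mem_iff]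
  exact commutator_mem_lcs_succ hx g

/-- `γ_n` is normal: conjugates stay in `γ_n`. [folklore] -/
theorem conj_mem_lcs {n : ℕ} (g : G) {x : G} (hx : x ∈ lcs G n) : g * x * g⁻¹ ∈ lcs G n :=
  (inferInstance : (lcs G n).Normal).conj_mem x hx g

/-! ## The pieces `γ_n/γ_{n+1}` -/

variable (G)

/-- The **degree-`n` piece** `γ_n(G)/γ_{n+1}(G)` of `gr(G)`, an additive commutative group.
[cite: Labute1970, §1 (gr(G) = ⊕ Gₙ/Gₙ₊₁)] -/
def LCSPiece (n : ℕ) : Type _ :=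
  Additive (↥(lcs G n) ⧸ (lcs G (n + 1)).subgroupOf (lcs G n))

namespace LCSPiece

variable {G}

/-- The class of `x ∈ γ_n` in `γ_n/γ_{n+1}`. [folklore] -/
def mk (n : ℕ) (x : G) (hx : x ∈ lcs G n) : LCSPiece G n :=
  Additive.ofMul (QuotientGroup.mk (s := (lcs G (n + 1)).subgroupOf (lcs G n)) ⟨x, hx⟩)

/-- The additive group structure of `γ_n/γ_{n+1}` (from the quotient group). [folklore] -/
instance instAddGroup (n : ℕ) : AddGroup (LCSPiece G n) :=
  inferInstanceAs (AddGroup (Additive (↥(lcs G n) ⧸ (lcs G (n + 1)).subgroupOf (lcs G n))))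

/-- Every element of `γ_n/γ_{n+1}` is a class. [folklore] -/
theorem mk_surjective (n : ℕ) (a : LCSPiece G n) : ∃ x, ∃ hx : x ∈ lcs G n, mk n x hx = a := by
  obtain ⟨⟨x, hx⟩, h⟩ := QuotientGroup.mk_surjective (Additive.toMul a)
  exact ⟨x, hx, by rw [mk, h]; rfl⟩

/-- Classes multiply to sums. [folklore] -/
theorem mk_mul (n : ℕ) {x y : G} (hx : x ∈ lcs G n) (hy : y ∈ lcs G n) :
    mk n (x * y) (mul_mem hx hy) = mk n x hx + mk n y hy := rfl

/-- The class of `1` is `0`. [folklore] -/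
theorem mk_one (n : ℕ) : mk n (1 : G) (one_mem _) = 0 := rfl

/-- Inverses go to negatives. [folklore] -/
theorem mk_inv (n : ℕ) {x : G} (hx : x ∈ lcs G n) : mk n x⁻¹ (inv_mem hx) = -mk n x hx := rfl

/-- Two classes agree iff the quotient lies in `γ_{n+1}`. [folklore] -/
theorem mk_eq_mk_iff (n : ℕ) {x y : G} (hx : x ∈ lcs G n) (hy : y ∈ lcs G n) :
    mk n x hx = mk n y hy ↔ x⁻¹ * y ∈ lcs G (n + 1) := by
  change (QuotientGroup.mk (s := (lcs G (n + 1)).subgroupOf (lcs G n)) ⟨x, hx⟩ : _ ⧸ _) =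
    QuotientGroup.mk ⟨y, hy⟩ ↔ _
  rw [QuotientGroup.eq, Subgroup.mem_subgroupOf]
  rfl

/-- A class vanishes iff the element lies in `γ_{n+1}`. [folklore] -/
theorem mk_eq_zero_iff (n : ℕ) {x : G} (hx : x ∈ lcs G n) : mk n x hx = 0 ↔ x ∈ lcs G (n + 1) := by
  rw [← mk_one n, mk_eq_mk_iff, mul_one, inv_mem_iff]

/-- `γ_n/γ_{n+1}` is commutative: `⁅γ_n, γ_n⁆ ⊆ ⁅γ_n, G⁆ = γ_{n+1}`. [folklore] -/
instance instAddCommGroup (n : ℕ) : AddCommGroup (LCSPiece G n) :=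
  { instAddGroup n with
    add_comm := by
      intro a b
      obtain ⟨x, hx, rfl⟩ := mk_surjective n a
      obtain ⟨y, hy, rfl⟩ := mk_surjective n b
      rw [← mk_mul, ← mk_mul, mk_eq_mk_iff]
      have : (x * y)⁻¹ * (y * x) = ⁅y⁻¹, x⁻¹⁆ := by group
      rw [this]
      exact commutator_mem_lcs_succ (inv_mem hy) _ }

end LCSPiece

/-! ## `gr(G) = ⊕ₙ γ_n/γ_{n+1}` and the symbol maps `toGr n : G → gr(G)` -/

/-- **`gr(G) = ⊕ₙ γ_n(G)/γ_{n+1}(G)`**, the associated graded abelian group of the lower central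
series (it becomes a Lie ring below). [cite: Labute1970, §1 (gr(G))] -/
def GrLCS : Type _ := DirectSum ℕ (LCSPiece G)

namespace GrLCS

/-- Additive structure of `gr(G)`. [folklore] -/
instance instAddCommGroup : AddCommGroup (GrLCS G) :=
  inferInstanceAs (AddCommGroup (DirectSum ℕ (LCSPiece G)))

/-- `gr(G)` is inhabited. [folklore] -/
instance instInhabited : Inhabited (GrLCS G) := ⟨0⟩

/-- The inclusion of the degree-`n` piece. [folklore] -/
def of (n : ℕ) : LCSPiece G n →+ GrLCS G := DirectSum.of (LCSPiece G) n

variable {G}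

/-- Induction on `gr(G)`: zero, homogeneous elements, sums. [folklore] -/
theorem induction_on {P : GrLCS G → Prop} (a : GrLCS G) (zero : P 0) (hof : ∀ n u, P (of G n u))
    (add : ∀ a b, P a → P b → P (a + b)) : P a :=
  DirectSum.induction_on a zero hof add

/-- Additive maps out of `gr(G)` from their components. [folklore] -/
def liftPieces {A : Type*} [AddCommMonoid A] (f : ∀ n, LCSPiece G n →+ A) : GrLCS G →+ A :=
  DirectSum.toAddMonoid f

/-- `liftPieces f` on a homogeneous element. [folklore] -/
@[simp] theorem liftPieces_of {A : Type*} [AddCommMonoid A] (f : ∀ n, LCSPiece G n →+ A) (n : ℕ)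
    (u : LCSPiece G n) : liftPieces f (of G n u) = f n u :=
  DirectSum.toAddMonoid_of f n u

/-- Two additive maps out of `gr(G)` agreeing on homogeneous elements are equal. [folklore] -/
theorem hom_ext {A : Type*} [AddCommMonoid A] {f g : GrLCS G →+ A}
    (h : ∀ n u, f (of G n u) = g (of G n u)) : f = g :=
  DirectSum.addHom_ext h

end GrLCS

variable {G}

open Classical in
/-- The **symbol map** `toGr n : G → gr(G)`: the class of `x` in `γ_n/γ_{n+1} ⊆ gr(G)` when
`x ∈ γ_n`, and `0` otherwise (junk value). [folklore] -/
noncomputable def toGr (G : Type*) [Group G] (n : ℕ) (x : G) : GrLCS G :=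
  if hx : x ∈ lcs G n then GrLCS.of G n (LCSPiece.mk n x hx) else 0

/-- On `γ_n`, `toGr n` is the class. [folklore] -/
theorem toGr_of_mem {n : ℕ} {x : G} (hx : x ∈ lcs G n) : toGr G n x = GrLCS.of G n (LCSPiece.mk n x hx) := by
  unfold toGr; rw [dif_pos hx]

/-- Off `γ_n`, `toGr n` is `0`. [folklore] -/
theorem toGr_of_not_mem {n : ℕ} {x : G} (hx : x ∉ lcs G n) : toGr G n x = 0 := by
  unfold toGr; rw [dif_neg hx]

/-- Homogeneous elements are symbols. [folklore] -/
theorem GrLCS.exists_toGr_eq (n : ℕ) (u : LCSPiece G n) : ∃ x, x ∈ lcs G n ∧ GrLCS.of G n u = toGr G n x := by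
  obtain ⟨x, hx, rfl⟩ := LCSPiece.mk_surjective n u
  exact ⟨x, hx, (toGr_of_mem hx).symm⟩

/-- Induction on `gr(G)` through symbols: zero, `toGr n x` (`x ∈ γ_n`), sums. [folklore] -/
theorem GrLCS.induction_on_toGr {P : GrLCS G → Prop} (a : GrLCS G) (zero : P 0)
    (symbol : ∀ n x, x ∈ lcs G n → P (toGr G n x)) (add : ∀ a b, P a → P b → P (a + b)) : P a :=
  GrLCS.induction_on a zero (fun n u => by
    obtain ⟨x, hx, h⟩ := GrLCS.exists_toGr_eq n u
    rw [h]; exact symbol n x hx) add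

/-- `toGr n (x y) = toGr n x + toGr n y` on `γ_n`. [folklore] -/
theorem toGr_mul {n : ℕ} {x y : G} (hx : x ∈ lcs G n) (hy : y ∈ lcs G n) :
    toGr G n (x * y) = toGr G n x + toGr G n y := by
  rw [toGr_of_mem hx, toGr_of_mem hy, toGr_of_mem (mul_mem hx hy), ← map_add]; rfl

/-- `toGr n 1 = 0`. [folklore] -/
@[simp] theorem toGr_one (n : ℕ) : toGr G n (1 : G) = 0 := by
  rw [toGr_of_mem (one_mem _), LCSPiece.mk_one, map_zero]

/-- `toGr n x⁻¹ = - toGr n x` on `γ_n`. [folklore] -/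
theorem toGr_inv {n : ℕ} {x : G} (hx : x ∈ lcs G n) : toGr G n x⁻¹ = -toGr G n x := by
  rw [toGr_of_mem hx, toGr_of_mem (inv_mem hx), ← map_neg]; rfl

/-- `toGr n` kills `γ_{n+1}`. [folklore] -/
theorem toGr_eq_zero_of_mem_succ {n : ℕ} {x : G} (hx : x ∈ lcs G (n + 1)) : toGr G n x = 0 := by
  rw [toGr_of_mem (lcs_succ_le n hx), (LCSPiece.mk_eq_zero_iff n _).2 hx, map_zero]

/-- `of n` is injective. [folklore] -/
theorem GrLCS.of_injective (n : ℕ) : Function.Injective (GrLCS.of G n) :=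
  DirectSum.of_injective n

/-- For `x ∈ γ_n`: `toGr n x = 0 ↔ x ∈ γ_{n+1}`. [folklore] -/
theorem toGr_eq_zero_iff {n : ℕ} {x : G} (hx : x ∈ lcs G n) : toGr G n x = 0 ↔ x ∈ lcs G (n + 1) := by
  rw [toGr_of_mem hx, ← LCSPiece.mk_eq_zero_iff n hx, ← (GrLCS.of G n).map_zero,
    (GrLCS.of_injective n).eq_iff]

/-- For `x, y ∈ γ_n`: `toGr n x = toGr n y ↔ x⁻¹ y ∈ γ_{n+1}`. [folklore] -/
theorem toGr_eq_toGr_iff {n : ℕ} {x y : G} (hx : x ∈ lcs G n) (hy : y ∈ lcs G n) :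
    toGr G n x = toGr G n y ↔ x⁻¹ * y ∈ lcs G (n + 1) := by
  rw [toGr_of_mem hx, toGr_of_mem hy, (GrLCS.of_injective n).eq_iff, LCSPiece.mk_eq_mk_iff]

/-- Multiplying by an element of `γ_{n+1}` does not change the symbol. [folklore] -/
theorem toGr_mul_of_mem_succ {n : ℕ} {x s : G} (hx : x ∈ lcs G n) (hs : s ∈ lcs G (n + 1)) :
    toGr G n (x * s) = toGr G n x := by
  rw [toGr_mul hx (lcs_succ_le n hs), toGr_eq_zero_of_mem_succ hs, add_zero]

/-- Multiplying on the left by an element of `γ_{n+1}` does not change the symbol. [folklore] -/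
theorem toGr_mul_of_mem_succ' {n : ℕ} {s x : G} (hs : s ∈ lcs G (n + 1)) (hx : x ∈ lcs G n) :
    toGr G n (s * x) = toGr G n x := by
  rw [toGr_mul (lcs_succ_le n hs) hx, toGr_eq_zero_of_mem_succ hs, zero_add]

/-- Conjugation acts trivially on symbols: `toGr n (g x g⁻¹) = toGr n x`. [folklore] -/
theorem toGr_conj {n : ℕ} (g : G) {x : G} (hx : x ∈ lcs G n) : toGr G n (g * x * g⁻¹) = toGr G n x := by
  have : g * x * g⁻¹ = ⁅g, x⁆ * x := by group
  rw [this, toGr_mul_of_mem_succ' (commutator_mem_lcs_succ' g hx) hx]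

/-! ## The commutator on symbols: congruences -/

/-- Skew-symmetry of the commutator symbol: `toGr N ⁅y, x⁆ = - toGr N ⁅x, y⁆`. [folklore] -/
theorem toGr_commutator_swap {N : ℕ} {x y : G} (h : ⁅x, y⁆ ∈ lcs G N) : toGr G N ⁅y, x⁆ = -toGr G N ⁅x, y⁆ := by
  rw [← commutatorElement_inv, toGr_inv h]

/-- Left multiplicativity: `toGr ⁅x x', y⁆ = toGr ⁅x, y⁆ + toGr ⁅x', y⁆` in degree `m + n + 1` for
`x, x' ∈ γ_m`, `y ∈ γ_n`. [folklore] -/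
theorem toGr_commutator_mul_left {m n N : ℕ} (h : m + n + 1 = N) {x x' y : G} (hx : x ∈ lcs G m)
    (hx' : x' ∈ lcs G m) (hy : y ∈ lcs G n) :
    toGr G N ⁅x * x', y⁆ = toGr G N ⁅x, y⁆ + toGr G N ⁅x', y⁆ := by
  rw [commutatorElement_mul_left_eq_conj_mul, toGr_mul (conj_mem_lcs x (commutator_mem_lcs_of_eq h hx' hy))
    (commutator_mem_lcs_of_eq h hx hy), toGr_conj x (commutator_mem_lcs_of_eq h hx' hy), add_comm]

/-- Right multiplicativity: `toGr ⁅x, y y'⁆ = toGr ⁅x, y⁆ + toGr ⁅x, y'⁆`. [folklore] -/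
theorem toGr_commutator_mul_right {m n N : ℕ} (h : m + n + 1 = N) {x y y' : G} (hx : x ∈ lcs G m)
    (hy : y ∈ lcs G n) (hy' : y' ∈ lcs G n) :
    toGr G N ⁅x, y * y'⁆ = toGr G N ⁅x, y⁆ + toGr G N ⁅x, y'⁆ := by
  rw [commutatorElement_mul_right_eq_mul_conj, mul_assoc (⁅x, y⁆ * y), mul_assoc ⁅x, y⁆,
    toGr_mul (commutator_mem_lcs_of_eq h hx hy) ?_, ← mul_assoc, toGr_conj y (commutator_mem_lcs_of_eq h hx hy')]
  rw [← mul_assoc]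
  exact conj_mem_lcs y (commutator_mem_lcs_of_eq h hx hy')

/-- Inverting the left argument negates the symbol. [folklore] -/
theorem toGr_commutator_inv_left {m n N : ℕ} (h : m + n + 1 = N) {x y : G} (hx : x ∈ lcs G m)
    (hy : y ∈ lcs G n) : toGr G N ⁅x⁻¹, y⁆ = -toGr G N ⁅x, y⁆ := by
  rw [eq_neg_iff_add_eq_zero, add_comm, ← toGr_commutator_mul_left h hx (inv_mem hx) hy, mul_inv_cancel,
    commutatorElement_one_left, toGr_one]

/-- Inverting the right argument negates the symbol. [folklore] -/
theorem toGr_commutator_inv_right {m n N : ℕ} (h : m + n + 1 = N) {x y : G} (hx : x ∈ lcs G m)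
    (hy : y ∈ lcs G n) : toGr G N ⁅x, y⁻¹⁆ = -toGr G N ⁅x, y⁆ := by
  rw [eq_neg_iff_add_eq_zero, add_comm, ← toGr_commutator_mul_right h hx hy (inv_mem hy), mul_inv_cancel,
    commutatorElement_one_right, toGr_one]

/-- The symbol of `⁅x, y⁆` only depends on `x` modulo `γ_{m+1}`. [folklore] -/
theorem toGr_commutator_congr_left {m n N : ℕ} (h : m + n + 1 = N) {x s y : G} (hx : x ∈ lcs G m)
    (hs : s ∈ lcs G (m + 1)) (hy : y ∈ lcs G n) : toGr G N ⁅x * s, y⁆ = toGr G N ⁅x, y⁆ := by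
  rw [toGr_commutator_mul_left h hx (lcs_succ_le m hs) hy, add_eq_left]
  refine toGr_eq_zero_of_mem_succ ?_
  have := commutator_mem_lcs hs hy
  rwa [show m + 1 + n + 1 = N + 1 by omega] at this

/-- The symbol of `⁅x, y⁆` only depends on `y` modulo `γ_{n+1}`. [folklore] -/
theorem toGr_commutator_congr_right {m n N : ℕ} (h : m + n + 1 = N) {x y t : G} (hx : x ∈ lcs G m)
    (hy : y ∈ lcs G n) (ht : t ∈ lcs G (n + 1)) : toGr G N ⁅x, y * t⁆ = toGr G N ⁅x, y⁆ := by
  rw [toGr_commutator_mul_right h hx hy (lcs_succ_le n ht), add_eq_left]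
  refine toGr_eq_zero_of_mem_succ ?_
  have := commutator_mem_lcs hx ht
  rwa [show m + (n + 1) + 1 = N + 1 by omega] at this

/-- **Jacobi for symbols** (from the Hall–Witt identity): for `x ∈ γ_i`, `y ∈ γ_j`, `z ∈ γ_k` and
`N = i + j + k + 2`, `toGr N ⁅⁅x, y⁆, z⁆ + toGr N ⁅⁅y, z⁆, x⁆ + toGr N ⁅⁅z, x⁆, y⁆ = 0`. [folklore] -/
theorem toGr_jacobi_cyclic {i j k N : ℕ} (h : i + j + k + 2 = N) {x y z : G} (hx : x ∈ lcs G i)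
    (hy : y ∈ lcs G j) (hz : z ∈ lcs G k) :
    toGr G N ⁅⁅x, y⁆, z⁆ + toGr G N ⁅⁅y, z⁆, x⁆ + toGr G N ⁅⁅z, x⁆, y⁆ = 0 := by
  -- Hall–Witt: `⁅⁅x, y⁆, y z y⁻¹⁆ * ⁅⁅y, z⁆, z x z⁻¹⁆ * ⁅⁅z, x⁆, x y x⁻¹⁆ = 1`, and each conjugate
  -- `y z y⁻¹ = z * ⁅z⁻¹, y⁆` differs from `z` by an element one step deeper.
  have hxy : ⁅x, y⁆ ∈ lcs G (i + j + 1) := commutator_mem_lcs hx hy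
  have hyz : ⁅y, z⁆ ∈ lcs G (j + k + 1) := commutator_mem_lcs hy hz
  have hzx : ⁅z, x⁆ ∈ lcs G (k + i + 1) := commutator_mem_lcs hz hx
  have e1 : toGr G N ⁅⁅x, y⁆, y * z * y⁻¹⁆ = toGr G N ⁅⁅x, y⁆, z⁆ := by
    have : y * z * y⁻¹ = z * ⁅z⁻¹, y⁆ := by group
    rw [this]
    refine toGr_commutator_congr_right (by omega) hxy hz ?_
    exact lcs_antitone (by omega) (commutator_mem_lcs (inv_mem hz) hy)
  have e2 : toGr G N ⁅⁅y, z⁆, z * x * z⁻¹⁆ = toGr G N ⁅⁅y, z⁆, x⁆ := by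
    have : z * x * z⁻¹ = x * ⁅x⁻¹, z⁆ := by group
    rw [this]
    refine toGr_commutator_congr_right (by omega) hyz hx ?_
    exact lcs_antitone (by omega) (commutator_mem_lcs (inv_mem hx) hz)
  have e3 : toGr G N ⁅⁅z, x⁆, x * y * x⁻¹⁆ = toGr G N ⁅⁅z, x⁆, y⁆ := by
    have : x * y * x⁻¹ = y * ⁅y⁻¹, x⁆ := by group
    rw [this]
    refine toGr_commutator_congr_right (by omega) hzx hy ?_
    exact lcs_antitone (by omega) (commutator_mem_lcs (inv_mem hy) hx)
  have m1 : ⁅⁅x, y⁆, y * z * y⁻¹⁆ ∈ lcs G N :=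
    commutator_mem_lcs_of_eq (by omega) hxy (conj_mem_lcs y hz)
  have m2 : ⁅⁅y, z⁆, z * x * z⁻¹⁆ ∈ lcs G N :=
    commutator_mem_lcs_of_eq (by omega) hyz (conj_mem_lcs z hx)
  have m3 : ⁅⁅z, x⁆, x * y * x⁻¹⁆ ∈ lcs G N :=
    commutator_mem_lcs_of_eq (by omega) hzx (conj_mem_lcs x hy)
  have key := commutatorElement_commutatorElement_conj_mul x y z
  have := congrArg (toGr G N) key
  rw [toGr_mul (mul_mem m1 m2) m3, toGr_mul m1 m2, toGr_one, e1, e2, e3] at this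
  exact this

/-! ## The bracket on `gr(G)` -/

namespace GrLCS

/-- The bracket of two homogeneous classes, computed on representatives:
`(x̄, ȳ) ↦ toGr (m+n+1) ⁅x, y⁆` (well defined by the congruences above). [folklore] -/
noncomputable def cbrFun (m n : ℕ) (a : LCSPiece G m) (b : LCSPiece G n) : GrLCS G :=
  Quotient.liftOn₂' (Additive.toMul a) (Additive.toMul b)
    (fun x y => toGr G (m + n + 1) ⁅(x : G), (y : G)⁆)
    (by
      intro x₁ y₁ x₂ y₂ hx hy
      replace hx := QuotientGroup.leftRel_apply.mp hx
      replace hy := QuotientGroup.leftRel_apply.mp hy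
      rw [Subgroup.mem_subgroupOf] at hx hy
      change toGr G (m + n + 1) ⁅(x₁ : G), (y₁ : G)⁆ = toGr G (m + n + 1) ⁅(x₂ : G), (y₂ : G)⁆
      have ex : (x₂ : G) = x₁ * ((x₁⁻¹ * x₂ : ↥(lcs G m)) : G) := by simp
      have ey : (y₂ : G) = y₁ * ((y₁⁻¹ * y₂ : ↥(lcs G n)) : G) := by simp
      rw [ex, ey, toGr_commutator_congr_left rfl x₁.2 hx (mul_mem y₁.2 (lcs_succ_le n hy)),
        toGr_commutator_congr_right rfl x₁.2 y₁.2 hy])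

/-- The bracket of classes is the symbol of the commutator. [folklore] -/
theorem cbrFun_mk_mk (m n : ℕ) {x y : G} (hx : x ∈ lcs G m) (hy : y ∈ lcs G n) :
    cbrFun m n (LCSPiece.mk m x hx) (LCSPiece.mk n y hy) = toGr G (m + n + 1) ⁅x, y⁆ := rfl

/-- Additivity of the component bracket in the first variable. [folklore] -/
theorem cbrFun_add_left (m n : ℕ) (a a' : LCSPiece G m) (b : LCSPiece G n) :
    cbrFun m n (a + a') b = cbrFun m n a b + cbrFun m n a' b := by
  obtain ⟨x, hx, rfl⟩ := LCSPiece.mk_surjective m a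
  obtain ⟨x', hx', rfl⟩ := LCSPiece.mk_surjective m a'
  obtain ⟨y, hy, rfl⟩ := LCSPiece.mk_surjective n b
  rw [← LCSPiece.mk_mul, cbrFun_mk_mk, cbrFun_mk_mk, cbrFun_mk_mk,
    toGr_commutator_mul_left rfl hx hx' hy]

/-- Additivity of the component bracket in the second variable. [folklore] -/
theorem cbrFun_add_right (m n : ℕ) (a : LCSPiece G m) (b b' : LCSPiece G n) :
    cbrFun m n a (b + b') = cbrFun m n a b + cbrFun m n a b' := by
  obtain ⟨x, hx, rfl⟩ := LCSPiece.mk_surjective m a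
  obtain ⟨y, hy, rfl⟩ := LCSPiece.mk_surjective n b
  obtain ⟨y', hy', rfl⟩ := LCSPiece.mk_surjective n b'
  rw [← LCSPiece.mk_mul, cbrFun_mk_mk, cbrFun_mk_mk, cbrFun_mk_mk,
    toGr_commutator_mul_right rfl hx hy hy']

/-- The component bracket as a biadditive map. [folklore] -/
noncomputable def cbrHom (m n : ℕ) : LCSPiece G m →+ LCSPiece G n →+ GrLCS G :=
  AddMonoidHom.mk' (fun a => AddMonoidHom.mk' (fun b => cbrFun m n a b) (cbrFun_add_right m n a))
    (fun a a' => by ext b; exact cbrFun_add_left m n a a' b)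

/-- `cbrHom` evaluates to `cbrFun`. [folklore] -/
@[simp] theorem cbrHom_apply (m n : ℕ) (a : LCSPiece G m) (b : LCSPiece G n) :
    cbrHom m n a b = cbrFun m n a b := rfl

/-- **The bracket of `gr(G)`** as a biadditive map, assembled from the components. [folklore] -/
noncomputable def bracketHom : GrLCS G →+ GrLCS G →+ GrLCS G :=
  liftPieces fun m => AddMonoidHom.flip (liftPieces fun n => (cbrHom (G := G) m n).flip)

/-- The bracket of `gr(G)` (notation `⁅a, b⁆`). [folklore] -/
noncomputable instance instBracket : Bracket (GrLCS G) (GrLCS G) := ⟨fun a b => bracketHom a b⟩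

/-- Unfolding the bracket. [folklore] -/
theorem bracket_def (a b : GrLCS G) : ⁅a, b⁆ = bracketHom a b := rfl

/-- The bracket of homogeneous classes. [folklore] -/
theorem of_lie_of (m n : ℕ) (u : LCSPiece G m) (v : LCSPiece G n) :
    ⁅of G m u, of G n v⁆ = cbrFun m n u v := by
  rw [bracket_def, bracketHom, liftPieces_of, AddMonoidHom.flip_apply, liftPieces_of,
    AddMonoidHom.flip_apply, cbrHom_apply]

/-- The bracket is additive on the left. [folklore] -/
theorem add_lie' (a b c : GrLCS G) : ⁅a + b, c⁆ = ⁅a, c⁆ + ⁅b, c⁆ := by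
  simp only [bracket_def, map_add, AddMonoidHom.add_apply]

/-- The bracket is additive on the right. [folklore] -/
theorem lie_add' (a b c : GrLCS G) : ⁅a, b + c⁆ = ⁅a, b⁆ + ⁅a, c⁆ := by
  simp only [bracket_def, map_add]

/-- `⁅0, a⁆ = 0`. [folklore] -/
@[simp] theorem zero_lie' (a : GrLCS G) : ⁅(0 : GrLCS G), a⁆ = 0 := by
  simp only [bracket_def, map_zero, AddMonoidHom.zero_apply]

/-- `⁅a, 0⁆ = 0`. [folklore] -/
@[simp] theorem lie_zero' (a : GrLCS G) : ⁅a, (0 : GrLCS G)⁆ = 0 := by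
  simp only [bracket_def, map_zero]

/-- `⁅-a, b⁆ = -⁅a, b⁆`. [folklore] -/
theorem neg_lie' (a b : GrLCS G) : ⁅-a, b⁆ = -⁅a, b⁆ := by
  simp only [bracket_def, map_neg, AddMonoidHom.neg_apply]

/-- `⁅a, -b⁆ = -⁅a, b⁆`. [folklore] -/
theorem lie_neg' (a b : GrLCS G) : ⁅a, -b⁆ = -⁅a, b⁆ := by
  simp only [bracket_def, map_neg]

end GrLCS

/-- **The bracket of symbols is the symbol of the commutator**:
`⁅toGr m x, toGr n y⁆ = toGr (m + n + 1) ⁅x, y⁆` for `x ∈ γ_m`, `y ∈ γ_n`.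
[cite: Labute1970, §1 (the bracket of gr(G) is induced by the commutator)] -/
theorem lie_toGr_toGr {m n : ℕ} {x y : G} (hx : x ∈ lcs G m) (hy : y ∈ lcs G n) :
    ⁅toGr G m x, toGr G n y⁆ = toGr G (m + n + 1) ⁅x, y⁆ := by
  rw [toGr_of_mem hx, toGr_of_mem hy, GrLCS.of_lie_of, GrLCS.cbrFun_mk_mk]

/-- Same, with a prescribed target degree `N = m + n + 1`. [folklore] -/
theorem lie_toGr_toGr_of_eq {m n N : ℕ} (h : m + n + 1 = N) {x y : G} (hx : x ∈ lcs G m)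
    (hy : y ∈ lcs G n) : ⁅toGr G m x, toGr G n y⁆ = toGr G N ⁅x, y⁆ :=
  h ▸ lie_toGr_toGr hx hy

namespace GrLCS

/-- The bracket is skew-symmetric. [folklore] -/
theorem lie_skew' (a b : GrLCS G) : ⁅a, b⁆ = -⁅b, a⁆ := by
  induction a using GrLCS.induction_on_toGr with
  | zero => rw [zero_lie', lie_zero', neg_zero]
  | symbol m x hx =>
    induction b using GrLCS.induction_on_toGr with
    | zero => rw [zero_lie', lie_zero', neg_zero]
    | symbol n y hy =>
      rw [lie_toGr_toGr hx hy, lie_toGr_toGr hy hx, Nat.add_comm n m,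
        toGr_commutator_swap (commutator_mem_lcs hx hy), neg_neg]
    | add b c hb hc => rw [lie_add', add_lie', hb, hc, neg_add]
  | add a a' ha ha' => rw [add_lie', lie_add', ha, ha', neg_add]

/-- The bracket is alternating. [folklore] -/
theorem lie_self' (a : GrLCS G) : ⁅a, a⁆ = 0 := by
  induction a using GrLCS.induction_on_toGr with
  | zero => exact zero_lie' 0
  | symbol m x hx => rw [lie_toGr_toGr hx hx, commutatorElement_self, toGr_one]
  | add a b ha hb =>
    rw [add_lie', lie_add', lie_add', ha, hb, zero_add, add_zero, lie_skew' a b, neg_add_cancel]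

/-- The Leibniz (Jacobi) identity for three symbols. [folklore] -/
theorem leibniz_toGr {i j k : ℕ} {x y z : G} (hx : x ∈ lcs G i) (hy : y ∈ lcs G j) (hz : z ∈ lcs G k) :
    ⁅toGr G i x, ⁅toGr G j y, toGr G k z⁆⁆ =
      ⁅⁅toGr G i x, toGr G j y⁆, toGr G k z⁆ + ⁅toGr G j y, ⁅toGr G i x, toGr G k z⁆⁆ := by
  have hyz := commutator_mem_lcs hy hz
  have hxy := commutator_mem_lcs hx hy
  have hxz := commutator_mem_lcs hx hz
  rw [lie_toGr_toGr hy hz, lie_toGr_toGr hx hy, lie_toGr_toGr hx hz,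
    lie_toGr_toGr_of_eq (N := i + j + k + 2) (by omega) hx hyz,
    lie_toGr_toGr_of_eq (N := i + j + k + 2) (by omega) hxy hz,
    lie_toGr_toGr_of_eq (N := i + j + k + 2) (by omega) hy hxz]
  have J := toGr_jacobi_cyclic (N := i + j + k + 2) rfl hx hy hz
  have e1 : toGr G (i + j + k + 2) ⁅x, ⁅y, z⁆⁆ = -toGr G (i + j + k + 2) ⁅⁅y, z⁆, x⁆ :=
    toGr_commutator_swap (commutator_mem_lcs_of_eq (by omega) hyz hx)
  have e2 : toGr G (i + j + k + 2) ⁅⁅z, x⁆, y⁆ = toGr G (i + j + k + 2) ⁅y, ⁅x, z⁆⁆ := by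
    rw [toGr_commutator_swap (commutator_mem_lcs_of_eq (by omega) hy (commutator_mem_lcs hz hx)),
      ← commutatorElement_inv x z, toGr_commutator_inv_right (by omega) hy hxz, neg_neg]
  rw [e1, ← e2]
  refine neg_eq_of_add_eq_zero_right ?_
  rw [← J]; abel

/-- **`gr(G)` is a Lie ring** (Magnus–Witt–Lazard). [cite: Labute1970, §1 (gr(G) is a graded Lie algebra over ℤ)] -/
noncomputable instance instLieRing : LieRing (GrLCS G) where
  add_lie := add_lie'
  lie_add := lie_add'
  lie_self := lie_self'
  leibniz_lie a b c := by
    induction a using GrLCS.induction_on_toGr generalizing b c with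
    | zero => simp only [zero_lie', lie_zero', zero_add]
    | add a a' ha ha' => simp only [add_lie', lie_add', ha, ha']; abel
    | symbol i x hx =>
      induction b using GrLCS.induction_on_toGr generalizing c with
      | zero => simp only [zero_lie', lie_zero', zero_add]
      | add b b' hb hb' => simp only [add_lie', lie_add', hb, hb']; abel
      | symbol j y hy =>
        induction c using GrLCS.induction_on_toGr with
        | zero => simp only [lie_zero', add_zero]
        | add c c' hc hc' => simp only [lie_add', hc, hc']; abel
        | symbol k z hz => exact leibniz_toGr hx hy hz

/-! ## Maps out of `gr(G)` -/

/-- An additive map `γ_n/γ_{n+1} → A` from a function on `G` additive on `γ_n` and vanishing on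
`γ_{n+1}`. [folklore] -/
noncomputable def _root_.Literature.GroupTheory.CombinatorialGroupTheory.LCSPiece.lift (n : ℕ)
    {A : Type*} [AddCommGroup A] (F : G → A)
    (hmul : ∀ x ∈ lcs G n, ∀ y ∈ lcs G n, F (x * y) = F x + F y) (hker : ∀ x ∈ lcs G (n + 1), F x = 0) :
    LCSPiece G n →+ A where
  toFun a := Quotient.liftOn' (Additive.toMul a) (fun x => F x)
    (by
      intro x y hxy
      replace hxy := QuotientGroup.leftRel_apply.mp hxy
      rw [Subgroup.mem_subgroupOf] at hxy
      change F x = F y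
      have ey : (y : G) = x * ((x⁻¹ * y : ↥(lcs G n)) : G) := by simp
      rw [ey, hmul _ x.2 _ (x⁻¹ * y).2, hker _ hxy, add_zero])
  map_zero' := by
    change F ((1 : ↥(lcs G n)) : G) = 0
    have h := hmul 1 (one_mem _) 1 (one_mem _)
    rw [mul_one] at h
    exact left_eq_add.mp h
  map_add' a b := by
    obtain ⟨x, hx, rfl⟩ := LCSPiece.mk_surjective n a
    obtain ⟨y, hy, rfl⟩ := LCSPiece.mk_surjective n b
    rw [← LCSPiece.mk_mul]
    exact hmul x hx y hy

/-- `LCSPiece.lift` on a class. [folklore] -/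
@[simp] theorem _root_.Literature.GroupTheory.CombinatorialGroupTheory.LCSPiece.lift_mk (n : ℕ)
    {A : Type*} [AddCommGroup A] (F : G → A)
    (hmul : ∀ x ∈ lcs G n, ∀ y ∈ lcs G n, F (x * y) = F x + F y) (hker : ∀ x ∈ lcs G (n + 1), F x = 0)
    {x : G} (hx : x ∈ lcs G n) : LCSPiece.lift n F hmul hker (LCSPiece.mk n x hx) = F x := rfl

/-- **Additive maps out of `gr(G)`** from degreewise data: functions `F n : G → A` additive on `γ_n`
and vanishing on `γ_{n+1}`. [folklore] -/
noncomputable def lift {A : Type*} [AddCommGroup A] (F : ℕ → G → A)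
    (hmul : ∀ n, ∀ x ∈ lcs G n, ∀ y ∈ lcs G n, F n (x * y) = F n x + F n y)
    (hker : ∀ n, ∀ x ∈ lcs G (n + 1), F n x = 0) : GrLCS G →+ A :=
  liftPieces fun n => LCSPiece.lift n (F n) (hmul n) (hker n)

/-- `lift F` on a symbol: `lift F (toGr n x) = F n x` for `x ∈ γ_n`. [folklore] -/
@[simp] theorem lift_toGr {A : Type*} [AddCommGroup A] (F : ℕ → G → A)
    (hmul : ∀ n, ∀ x ∈ lcs G n, ∀ y ∈ lcs G n, F n (x * y) = F n x + F n y)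
    (hker : ∀ n, ∀ x ∈ lcs G (n + 1), F n x = 0) {n : ℕ} {x : G} (hx : x ∈ lcs G n) :
    lift F hmul hker (toGr G n x) = F n x := by
  rw [toGr_of_mem hx, lift, liftPieces_of, LCSPiece.lift_mk]

/-- Two additive maps out of `gr(G)` agreeing on all symbols are equal. [folklore] -/
theorem hom_ext_toGr {A : Type*} [AddCommGroup A] {f g : GrLCS G →+ A}
    (h : ∀ n x, x ∈ lcs G n → f (toGr G n x) = g (toGr G n x)) : f = g :=
  hom_ext fun n u => by
    obtain ⟨x, hx, e⟩ := exists_toGr_eq n u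
    rw [e]; exact h n x hx

/-- **Lie ring morphisms out of `gr(G)`**: if moreover `F (m+n+1) ⁅x, y⁆ = ⁅F m x, F n y⁆` for
`x ∈ γ_m`, `y ∈ γ_n`, then `lift F` is a morphism of Lie rings. [folklore] -/
noncomputable def liftLie {A : Type*} [LieRing A] (F : ℕ → G → A)
    (hmul : ∀ n, ∀ x ∈ lcs G n, ∀ y ∈ lcs G n, F n (x * y) = F n x + F n y)
    (hker : ∀ n, ∀ x ∈ lcs G (n + 1), F n x = 0)
    (hlie : ∀ m n, ∀ x ∈ lcs G m, ∀ y ∈ lcs G n, F (m + n + 1) ⁅x, y⁆ = ⁅F m x, F n y⁆) :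
    GrLCS G →ₗ⁅ℤ⁆ A :=
  { (lift F hmul hker).toIntLinearMap with
    map_lie' := by
      intro a b
      change lift F hmul hker ⁅a, b⁆ = ⁅lift F hmul hker a, lift F hmul hker b⁆
      induction a using GrLCS.induction_on_toGr with
      | zero => rw [zero_lie', map_zero, zero_lie]
      | add a a' ha ha' => rw [add_lie', map_add, map_add, ha, ha', add_lie]
      | symbol m x hx =>
        induction b using GrLCS.induction_on_toGr with
        | zero => rw [lie_zero', map_zero, lie_zero]
        | add b b' hb hb' => rw [lie_add', map_add, map_add, hb, hb', lie_add]
        | symbol n y hy =>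
          rw [lie_toGr_toGr hx hy, lift_toGr _ _ _ (commutator_mem_lcs hx hy), lift_toGr _ _ _ hx,
            lift_toGr _ _ _ hy, hlie m n x hx y hy] }

/-- `liftLie F` on a symbol. [folklore] -/
@[simp] theorem liftLie_toGr {A : Type*} [LieRing A] (F : ℕ → G → A)
    (hmul : ∀ n, ∀ x ∈ lcs G n, ∀ y ∈ lcs G n, F n (x * y) = F n x + F n y)
    (hker : ∀ n, ∀ x ∈ lcs G (n + 1), F n x = 0)
    (hlie : ∀ m n, ∀ x ∈ lcs G m, ∀ y ∈ lcs G n, F (m + n + 1) ⁅x, y⁆ = ⁅F m x, F n y⁆)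
    {n : ℕ} {x : G} (hx : x ∈ lcs G n) : liftLie F hmul hker hlie (toGr G n x) = F n x :=
  lift_toGr F hmul hker hx

/-- The symbols of degree `n` form the range of `of n`; in particular they form an additive subgroup.
[folklore] -/
theorem toGr_mem_range_of {n : ℕ} {x : G} (hx : x ∈ lcs G n) : toGr G n x ∈ (of G n).range := by
  rw [toGr_of_mem hx]; exact ⟨_, rfl⟩

/-- Conversely every element of the range of `of n` is a symbol. [folklore] -/
theorem exists_toGr_of_mem_range {n : ℕ} {a : GrLCS G} (ha : a ∈ (of G n).range) :
    ∃ x, x ∈ lcs G n ∧ a = toGr G n x := by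
  obtain ⟨u, rfl⟩ := ha
  exact exists_toGr_eq n u

end GrLCS

end Literature.GroupTheory.CombinatorialGroupTheory
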